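import Summits.Ventures.PercRepro.C041ZoneSplitSymm

/-!
# The ZONE LEMMA and (INV) on tail-free colourings as named statements, and the implication (p6, gen 26; C-041.md §11)

* `ZoneLemma a b c`: mine-3's ZONE LEMMA (C-041.md §11), side `a`, for the skeleton `(G; a, b, c)` — for every bare
  colouring `O` and every indexed zone `Z` of `O`, `#𝓛_Z ≤ #𝓡_Z`; the conjecture of record (census 2,351 zones /
  0 violations), NOT asserted.
* `INVConjTailFree a b c`: CONJECTURE (INV) (`INVConj`, `C041RcPortINV`) restricted to the tail-free bare colourings.
* **`INVConjTailFree_of_zoneLemma`**: the ZONE LEMMA on both sides implies (INV) on every tail-free colouring, when the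
  terminals are joined by an edge — the REDUCTION THEOREM of §11 as one implication between two named statements.
-/

namespace PercRepro

namespace MultiGraph

variable {V E : Type*} [Fintype V] [Fintype E] [DecidableEq E] (G : MultiGraph V E) (a b c : V)

/-- **mine-3's ZONE LEMMA** (C-041.md §11), side `a`: for every bare colouring `O` and every indexed zone `Z` of `O`,
`#𝓛_Z ≤ #𝓡_Z`.  A conjecture, not asserted. -/
def ZoneLemma : Prop :=
  ∀ (O : Config E) (Z : G.ZoneIdx a b c O), (G.Lset a b c O Z.1).card ≤ (G.Rset a b c O Z.1).card

/-- CONJECTURE (INV) restricted to the tail-free bare colourings: for every tail-free `O` and every vertex `u` of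
`K(O)` carrying no terminal edge, `I(O) ≤ m_a(u)` and `I(O) ≤ m_b(u)`. -/
def INVConjTailFree : Prop :=
  ∀ (O : Config E), G.TailFree a b c O → ∀ u : V, u ∈ G.BareReach a b c O →
    (¬ ∃ e, G.Joins e u a ∨ G.Joins e u b) →
      G.invalidCount a b c O ≤ G.mCountA a b c O u ∧ G.invalidCount a b c O ≤ G.mCountB a b c O u

variable {G a b c}

/-- **THE REDUCTION THEOREM OF §11 AS ONE IMPLICATION**: with an edge between the terminals, the ZONE LEMMA on both
sides implies (INV) on every tail-free bare colouring. -/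
theorem INVConjTailFree_of_zoneLemma (hc : c ≠ a ∧ c ≠ b) (hne : a ≠ b) (hab : ∃ e, G.Joins e a b)
    (hZa : G.ZoneLemma a b c) (hZb : G.ZoneLemma b a c) : G.INVConjTailFree a b c :=
  fun O hO _ hu _ => inv_of_zone a b c hc hne hab hO hu (hZa O) (hZb O)

omit [Fintype V] in
/-- (INV) restricted to the tail-free colourings follows from CONJECTURE (INV) itself. -/
theorem INVConjTailFree_of_INVConj (h : G.INVConj a b c) : G.INVConjTailFree a b c :=
  fun O _ u hu hfree => h O u hu hfree

end MultiGraph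

end PercRepro
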